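import Summits.AtomisticToContinuum.HydrodynamicLimit.Theses.MourreKoopmanCharges
import Summits.AtomisticToContinuum.HydrodynamicLimit.Theorems.TwoClocksEquilibriumShearWindowLDCentring
import Summits.AtomisticToContinuum.HydrodynamicLimit.Theorems.JParityClosureOddContactSymmetryGibbsInvariance
import HarnessLib

/-!
# `StressStrongMixing` · line `birth`, stub B1 `stub_torusStressRawEqCov`:
# the raw two-time stress moment is `(N+1)` times the two-time stress covariance

Support file for the crux item stmt-AtomisticToContinuum-9584 (`StressStrongMixing`, route
`MourreKoopmanCharges` of `AtomisticToContinuum/HydrodynamicLimit`), proving the registered stub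
`stub_torusStressRawEqCov` (B1, finite-`N` statics) of the skeleton
`Cruxes/StressStrongMixing/Lines/birth.lean`.

Under the canonical Gibbs law at rest `G_N = localGibbsLaw σ 1 0 θ N (Φ N)` of `N + 1` hard spheres on `𝕋³`,
the empirical kinetic shear-stress field `Π(χ)(z) = ∫ χ(y.1) (y.2 0 · y.2 1) d(empiricalMeasure z)
= (N+1)⁻¹ Σᵢ χ(xᵢ) vᵢ⁰ vᵢ¹` is CENTRED: `G_N` is invariant under the reflection `v⁰ ↦ -v⁰` of every
velocity (`measurePreserving_velIsometry_localGibbsLaw_const`), under which `Π(χ)` is odd — no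
integrability and no smallness of `σ` is needed (`integral_stressField_localGibbsLaw_const`).  The
time-shifted factor `Π(χ₁) ∘ Φ_t` has the same (vanishing) Gibbs mean by stationarity of `G_N` under the
hard-sphere flow (`integral_comp_flow_localGibbsLaw_const`; `Π(χ₁)` is measurable, being a finite sum of
continuous functions of the coordinates).  Since Mathlib's covariance is LITERALLY
`cov[X, Y; μ] = ∫ (X - μ[X]) (Y - μ[Y]) dμ`, two vanishing means give `cov[X, Y; G_N] = ∫ X Y dG_N` with no
integrability hypothesis (`covariance_eq_integral_mul_of_integral_eq_zero`), whence the stub after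
multiplying by `N + 1`.

References: H. Spohn, *Large Scale Dynamics of Interacting Particles* (1991), Part I §2.3–2.4 and §7.1.
-/

noncomputable section

open MeasureTheory ProbabilityTheory Filter Topology
open scoped InnerProductSpace ENNReal

namespace Summit.AtomisticToContinuum.HydrodynamicLimit.Theorems.MourreKoopmanChargesStressStrongMixing

open Literature.MathematicalPhysics.KineticTheory Literature.Analysis.FluidPDE

/-! ### Covariance with vanishing means -/

/-- **If both means vanish, the covariance is the raw second moment** — by the very definition
`cov[X, Y; μ] = ∫ (X - μ[X]) (Y - μ[Y]) dμ`; no integrability is needed. [folklore] -/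
theorem covariance_eq_integral_mul_of_integral_eq_zero {Ω : Type*} [MeasurableSpace Ω]
    {μ : Measure Ω} {X Y : Ω → ℝ} (hX : μ[X] = 0) (hY : μ[Y] = 0) :
    cov[X, Y; μ] = ∫ ω, X ω * Y ω ∂μ := by
  simp only [covariance, hX, hY, sub_zero]

/-! ### The empirical kinetic shear-stress field -/

/-- The empirical shear-stress field as a finite sum:
`∫ χ(y.1) (y.2 0 · y.2 1) d(empiricalMeasure z) = n⁻¹ Σᵢ χ(xᵢ) vᵢ⁰ vᵢ¹` (`integral_empiricalMeasure`). [folklore] -/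
theorem stressField_eq_sum {n : ℕ} (χ : T3 → ℝ) (z : Config n (Fin 3) T3) :
    ∫ y, χ y.1 * (y.2 0 * y.2 1) ∂(empiricalMeasure z) =
      (n : ℝ)⁻¹ * ∑ i, χ (z i).1 * ((z i).2 0 * (z i).2 1) :=
  integral_empiricalMeasure z _

/-- The empirical shear-stress field of a continuous test function is a measurable function of the
configuration (a finite sum of continuous functions of the coordinates). [folklore] -/
theorem measurable_stressField {n : ℕ} {χ : T3 → ℝ} (hχ : Continuous χ) :
    Measurable fun z : Config n (Fin 3) T3 => ∫ y, χ y.1 * (y.2 0 * y.2 1) ∂(empiricalMeasure z) := by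
  have hF : Continuous fun y : T3 × V3 => χ y.1 * (y.2 0 * y.2 1) := by fun_prop
  have h : (fun z : Config n (Fin 3) T3 => ∫ y, χ y.1 * (y.2 0 * y.2 1) ∂(empiricalMeasure z)) =
      fun z => (n : ℝ)⁻¹ * ∑ i, χ (z i).1 * ((z i).2 0 * (z i).2 1) :=
    funext fun z => stressField_eq_sum χ z
  rw [h]
  exact measurable_const.mul
    (Finset.measurable_sum _ fun i _ => hF.measurable.comp (measurable_pi_apply i))

/-- **The empirical shear-stress field is centred under the Gibbs law at rest**:
`∫ Π(χ) dG_N = 0` for `G_N = localGibbsLaw σ a 0 θ N Φ` and every `χ` — the law is invariant under the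
reflection `v⁰ ↦ -v⁰` of every velocity (`measurePreserving_velIsometry_localGibbsLaw_const`), under
which `Π(χ)` is odd; no integrability, positivity of `θ` or smallness of `σ` is needed. [folklore] -/
theorem integral_stressField_localGibbsLaw_const (σ a θ : ℝ) (N : ℕ)
    (Φ : HardSphereFlow (Torus.geometry (Fin 3)) (hsDiameter σ N) (N + 1)) (χ : T3 → ℝ) :
    ∫ z, (∫ y, χ y.1 * (y.2 0 * y.2 1) ∂(empiricalMeasure z))
      ∂(localGibbsLaw σ (fun _ => a) (fun _ => 0) (fun _ => θ) N Φ) = 0 := by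
  -- adapted from `integral_shearStress_localGibbsLaw_const` (TwoClocksEquilibriumShearWindowLDCentring)
  set R : V3 ≃ₗᵢ[ℝ] V3 := LinearIsometryEquiv.piLpCongrRight 2 fun i : Fin 3 =>
    if i = 0 then LinearIsometryEquiv.neg ℝ (E := ℝ) else LinearIsometryEquiv.refl ℝ ℝ with hRdef
  have hR : ∀ (v : V3) (i : Fin 3), R v i = if i = 0 then -v i else v i := by
    intro v i
    rw [hRdef, LinearIsometryEquiv.piLpCongrRight_apply, PiLp.toLp_apply]
    split_ifs <;> simp
  have hT := measurePreserving_velIsometry_localGibbsLaw_const σ a θ N Φ R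
  have hTe := measurableEmbedding_velIsometry (N + 1) R
  have h10 : (1 : Fin 3) ≠ 0 := by decide
  have hodd1 : ∀ (z : Config (N + 1) (Fin 3) T3) (i : Fin (N + 1)),
      χ (z i).1 * ((R (z i).2) 0 * (R (z i).2) 1) = -(χ (z i).1 * ((z i).2 0 * (z i).2 1)) := by
    intro z i
    rw [hR _ 0, hR _ 1, if_pos rfl, if_neg h10]
    ring
  have hodd : ∀ z : Config (N + 1) (Fin 3) T3,
      ∫ y, χ y.1 * (y.2 0 * y.2 1) ∂(empiricalMeasure (fun i => ((z i).1, R (z i).2))) =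
        -∫ y, χ y.1 * (y.2 0 * y.2 1) ∂(empiricalMeasure z) := by
    intro z
    rw [stressField_eq_sum χ (fun i => ((z i).1, R (z i).2)), stressField_eq_sum χ z, ← mul_neg,
      ← Finset.sum_neg_distrib]
    exact congrArg _ (Finset.sum_congr rfl fun i _ => hodd1 z i)
  have h := hT.integral_comp hTe
    (fun z : Config (N + 1) (Fin 3) T3 => ∫ y, χ y.1 * (y.2 0 * y.2 1) ∂(empiricalMeasure z))
  simp only [hodd, integral_neg] at h
  linarith

/-- **Stationarity of the stress-field mean**: under the Gibbs law at rest the time-shifted stress field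
`Π(χ) ∘ Φ_t` is centred too (`integral_comp_flow_localGibbsLaw_const` and
`integral_stressField_localGibbsLaw_const`). [folklore] -/
theorem integral_stressField_flow_localGibbsLaw_const (σ a θ : ℝ) (N : ℕ)
    (Φ : HardSphereFlow (Torus.geometry (Fin 3)) (hsDiameter σ N) (N + 1)) {χ : T3 → ℝ}
    (hχ : Continuous χ) (t : ℝ) :
    ∫ z, (∫ y, χ y.1 * (y.2 0 * y.2 1) ∂(empiricalMeasure (Φ.flow t z)))
      ∂(localGibbsLaw σ (fun _ => a) (fun _ => 0) (fun _ => θ) N Φ) = 0 :=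
  (integral_comp_flow_localGibbsLaw_const σ a θ 0 N Φ t
      (measurable_stressField (n := N + 1) hχ).aestronglyMeasurable).trans
    (integral_stressField_localGibbsLaw_const σ a θ N Φ χ)

/-! ### The registered stub -/

/-- **STUB B1 `stub_torusStressRawEqCov`** of the line `birth` of crux stmt-AtomisticToContinuum-9584
(`= TorusStressRawEqCov` of the skeleton, expanded): for every `σ, θ`, flow family, continuous `χ₁, χ₂`,
real `s` and `N`, the crux's RAW two-time stress moment
`(N+1) · E_{G_N}[Π(χ₁)(Φ_{s(N+1)^{-1/3}} z) · Π(χ₂)(z)]` equals `(N+1) · Cov_{G_N}(Π(χ₁) ∘ Φ_{s(N+1)^{-1/3}}, Π(χ₂))`: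
both factors are centred under the canonical law at rest (`integral_stressField_flow_localGibbsLaw_const`,
`integral_stressField_localGibbsLaw_const`), and the covariance of two centred functions is their raw
second moment by definition. (The hypotheses `0 < σ ≤ 1/2`, `0 < θ`, `Continuous χ₂` of the registered
signature are not used.) [folklore] -/
theorem stub_torusStressRawEqCov :
    ∀ σ : ℝ, 0 < σ → σ ≤ 1 / 2 → ∀ θ : ℝ, 0 < θ →
      ∀ Φ : (N : ℕ) → HardSphereFlow (Torus.geometry (Fin 3)) (hsDiameter σ N) (N + 1),
      ∀ χ₁ χ₂ : T3 → ℝ, Continuous χ₁ → Continuous χ₂ → ∀ (s : ℝ) (N : ℕ),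
        ((N : ℝ) + 1) * ∫ z, (∫ y, χ₁ y.1 * (y.2 0 * y.2 1)
            ∂(empiricalMeasure ((Φ N).flow (s * ((N : ℝ) + 1) ^ (-(1 / 3 : ℝ))) z))) *
          (∫ y, χ₂ y.1 * (y.2 0 * y.2 1) ∂(empiricalMeasure z))
          ∂(localGibbsLaw σ (fun _ => 1) (fun _ => 0) (fun _ => θ) N (Φ N)) =
        ((N : ℝ) + 1) *
          cov[fun z => ∫ y, χ₁ y.1 * (y.2 0 * y.2 1)
                ∂(empiricalMeasure ((Φ N).flow (s * ((N : ℝ) + 1) ^ (-(1 / 3 : ℝ))) z)),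
              fun z => ∫ y, χ₂ y.1 * (y.2 0 * y.2 1) ∂(empiricalMeasure z);
            localGibbsLaw σ (fun _ => 1) (fun _ => 0) (fun _ => θ) N (Φ N)] := by
  intro σ _hσ _hσ2 θ _hθ Φ χ₁ χ₂ hχ₁ _hχ₂ s N
  exact congrArg (fun r : ℝ => ((N : ℝ) + 1) * r)
    (covariance_eq_integral_mul_of_integral_eq_zero
      (integral_stressField_flow_localGibbsLaw_const σ 1 θ N (Φ N) hχ₁
        (s * ((N : ℝ) + 1) ^ (-(1 / 3 : ℝ))))
      (integral_stressField_localGibbsLaw_const σ 1 θ N (Φ N) χ₂)).symm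

end Summit.AtomisticToContinuum.HydrodynamicLimit.Theorems.MourreKoopmanChargesStressStrongMixing

end
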